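import Mathlib
import Summits.QuantumFields.YangMills.Theorems.LuscherReductionDressedRitzVacuumDictionaryLimits
import Summits.QuantumFields.YangMills.Theorems.LuscherReductionDressedRitzPolyakovLiftStaticsPrep
import Summits.QuantumFields.YangMills.Theorems.AdjointLoopFanoDirichletKinematic
import HarnessLib

/-!
# Crux `TransportFieldFano.MeanLoopCeilingWeak` ⟨stmt-QuantumFields-23353⟩, line `birth` (planner ym-idea-4 g17): the registered stub
# `stub_slabLimit` — CLOSED (the vacuum torelon-deviation mean is the limit of free-boundary slab one-point functions)

`SlabLimitP`: for `β > 0` and every `l2`-normalised physical vacuum `Ω` (`K_βΩ = λ₀Ω`), the one-point function of the site-averaged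
direction-`0` torelon deviation `F` in the free-boundary slab `Φ_m = K_β^m 1` converges to its vacuum value:
`⟨FΦ_m, Φ_m⟩/‖Φ_m‖² → ⟨FΩ, Ω⟩` as `m → ∞`.  This is the tree's VACUUM DICTIONARY `VacDict.tendsto_onePoint` (power iteration with the
Jentzsch gap, ✓ `LuscherReductionDressedRitzVacuumDictionaryLimits`) for the uniformly positive vacuum package `VacDict.exists_isVacuum`,
transported to an arbitrary normalised vacuum `Ω = ±Ω₊` by Jentzsch simplicity (`PolyakovLift.rawVacuum_eq_smul_of_gap`, pointwise).
HONEST FRAMING: fixed-lattice functional analysis (femto rung); the crux (its slab CEILING) is OPEN; K2a and the YM mass gap are NOT proved.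
No `sorry`, no new axiom; the `abbrev` is a registered-stub copy (verbatim), not a citable fact.
References: [cite: SeilerLNP1982, §3]; [cite: ReedSimonIV1978, Thm. XIII.43].
-/

set_option autoImplicit false

noncomputable section

open MeasureTheory Filter Topology
open scoped BigOperators
open Literature.MathematicalPhysics.QuantumFieldTheory (GaugeConfig Site)

namespace Summit.QuantumFields.YangMills.Theorems.TransportFieldFano

open Summit.QuantumFields.YangMills.Theorems.FemtoTransferGap
open Summit.QuantumFields.YangMills.Theorems.FemtoTransferGap.PhysL2
open Summit.QuantumFields.YangMills.Theorems.AdjointLoopFano (isPhys_adjLoop)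

variable {L : ℕ} [NeZero L]

/-- The Jentzsch gap of a vacuum package, in raw (`IsPhys`/`qform`) currency. [cite: ReedSimonIV1978, Thm. XIII.43] -/
theorem IsVacuum.raw_gap {β θ : ℝ} {Ωv : physSubmodule L} (hV : VacDict.IsVacuum β Ωv θ)
    (ψ : GaugeConfig 3 L SU2 → ℝ) (hψ : IsPhys ψ) (horth : l2 ψ (Ωv : GaugeConfig 3 L SU2 → ℝ) = 0) :
    qform su2Rep β ψ ψ ≤ θ * l2 ψ ψ := by
  have h := hV.gap ⟨ψ, hψ⟩ (by rw [l2Form_apply, l2_comm]; exact horth)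
  rw [l2Form_apply, l2Form_apply, coe_transferOp] at h
  rw [qform_eq_l2_transferApply]
  exact h

/-- **Any normalised physical vacuum has the one-point functions of the positive vacuum package**: `⟨fΩ, Ω⟩ = ⟨Ω₊, fΩ₊⟩`
(`Ω = ±Ω₊` pointwise by Jentzsch simplicity). [cite: ReedSimonIV1978, Thm. XIII.43] -/
theorem l2_mul_vacuum_eq_of_isVacuum {β θ : ℝ} {Ωv : physSubmodule L} (hV : VacDict.IsVacuum β Ωv θ)
    {Ω : GaugeConfig 3 L SU2 → ℝ} (hΩ : IsPhys Ω) (hn : l2 Ω Ω = 1) (heig : transferApply β Ω = topValue su2Rep L β • Ω)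
    (f : GaugeConfig 3 L SU2 → ℝ) :
    l2 (fun U => f U * Ω U) Ω = l2 (Ωv : GaugeConfig 3 L SU2 → ℝ) (f * (Ωv : GaugeConfig 3 L SU2 → ℝ)) := by
  obtain ⟨hΩv, hnv, heigv⟩ := hV.raw
  rw [levelValue_zero] at heigv
  have hθ : θ < topValue su2Rep L β := by rw [← levelValue_zero]; exact hV.theta_lt
  have hpt := PolyakovLift.rawVacuum_eq_smul_of_gap β hΩ heig hΩv hnv heigv hθ (fun ψ hψ h0 => IsVacuum.raw_gap hV ψ hψ h0)
  set a : ℝ := l2 Ω (Ωv : GaugeConfig 3 L SU2 → ℝ) with ha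
  have hfun : Ω = a • (Ωv : GaugeConfig 3 L SU2 → ℝ) := funext fun U => by rw [Pi.smul_apply, smul_eq_mul]; exact hpt U
  have ha2 : a * a = 1 := by
    have h2 : l2 Ω Ω = a * a * l2 (Ωv : GaugeConfig 3 L SU2 → ℝ) Ωv := by rw [hfun, OpPlat.l2_smul_smul]
    rw [hn, hnv, mul_one] at h2
    exact h2.symm
  unfold l2
  refine integral_congr_ae (ae_of_all _ fun U => ?_)
  dsimp only
  rw [hpt U, Pi.mul_apply]
  have : f U * (a * (Ωv : GaugeConfig 3 L SU2 → ℝ) U) * (a * (Ωv : GaugeConfig 3 L SU2 → ℝ) U) =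
      a * a * ((Ωv : GaugeConfig 3 L SU2 → ℝ) U * (f U * (Ωv : GaugeConfig 3 L SU2 → ℝ) U)) := by ring
  rw [this, ha2, one_mul]

/-- The registered stub statement `SlabLimitP` of line `birth` of crux ⟨stmt-QuantumFields-23353⟩ (verbatim copy of the skeleton's
`BirthMLC.SlabLimitP`; a registered-stub copy, not a citable fact). -/
abbrev SlabLimitP : Prop :=
  ∀ β : ℝ, 0 < β → ∀ (L : ℕ) [NeZero L], ∀ Ω : Literature.MathematicalPhysics.QuantumFieldTheory.GaugeConfig 3 L SU2 → ℝ, IsPhys Ω → l2 Ω Ω = 1 →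
    transferApply β Ω = topValue su2Rep L β • Ω →
    let F : Literature.MathematicalPhysics.QuantumFieldTheory.GaugeConfig 3 L SU2 → ℝ := flowLift 0 (fun u : Literature.MathematicalPhysics.QuantumFieldTheory.GaugeConfig 3 1 SU2 => 4 - ((su2Rep (u ((0 : Literature.MathematicalPhysics.QuantumFieldTheory.Site 3 1), (0 : Fin 3)))).trace.re) ^ 2)
    Tendsto (fun m : ℕ => l2 (fun U => F U * slabGround β m U) (slabGround β m) / l2 (slabGround (L := L) β m) (slabGround β m))
      atTop (𝓝 (l2 (fun U => F U * Ω U) Ω))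

/-- ★★ **`stub_slabLimit`** (registered stub of the birth skeleton of crux ⟨stmt-QuantumFields-23353⟩, signature `SlabLimitP` verbatim):
`⟨FΦ_m, Φ_m⟩/‖Φ_m‖² → ⟨FΩ, Ω⟩` for every normalised physical vacuum `Ω`, by the tree's vacuum dictionary. [cite: SeilerLNP1982, §3]
[cite: ReedSimonIV1978, Thm. XIII.43] -/
theorem stub_slabLimit : SlabLimitP := by
  intro β hβ L _ Ω hΩ hn heig
  dsimp only
  obtain ⟨Ωv, θ, c, hV, hc, hcle⟩ := VacDict.exists_isVacuum (L := L) β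
  have hΩ1 : l2Form L Ωv VacDict.one ≠ 0 := (VacDict.l2Form_vac_one_pos hc hcle).ne'
  have hF : IsPhys (flowLift (L := L) 0 (fun u : GaugeConfig 3 1 SU2 => 4 - ((su2Rep (u ((0 : Site 3 1), (0 : Fin 3)))).trace.re) ^ 2)) :=
    isPhys_adjLoop
  have ht := VacDict.tendsto_onePoint hV hβ.le hΩ1 hF
  rw [l2_mul_vacuum_eq_of_isVacuum hV hΩ hn heig]
  refine ht.congr' (Eventually.of_forall fun m => ?_)
  rw [l2_comm (slabGround β m)]
  rfl

end Summit.QuantumFields.YangMills.Theorems.TransportFieldFano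

end
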